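import Mathlib
import HarnessLib
import Summits.Ventures.LatticeQCDFlow.Exactness.SUNExpChartMinorisation
import Summits.Ventures.LatticeQCDFlow.Exactness.LinearSurjectionPushforward
import Summits.Ventures.LatticeQCDFlow.Exactness.SUNKickCoordinates
import Summits.Ventures.LatticeQCDFlow.Exactness.MetropolisSweepInstances

/-!
# The engine's `SU(N)` Metropolis kick covers: the N-hit link update is uniformly ergodic and the sweep converges to the `SU(N)` Wilson measure, every `N`

HONEST FRAMING: exact (Metropolis-corrected) sampling algorithms for lattice gauge theory;
figures of merit are autocorrelation/cost numbers at stated couplings and volumes; no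
continuum-physics claim.

Venture `LatticeQCDFlow` (cell pub-lqcd), topic `Exactness`, FANOUT row 9 (eng-latcore, the
engine `latflow.core.updates.sweep_metropolis_ref/_c` (4D) and `sun_2d.sweep_metropolis` (2D) for
GENERAL `N`: the proposal is `U ← exp(X) U`, `X` traceless anti-Hermitian with box-uniform
components — `d = step·(2u−1)` on the diagonal then `d −= mean(d)`, `re, im = step·(2u−1)` above
the diagonal, `X_ii = i d_i`, `X_ij = re + i im`, `X_ji = −re + i im`; accept `min(1, e^{−ΔS})`,
`nhit` hits per link, a scan through all links).  NEW WORK of the cell over the tree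
(`SUNKickCoordinates.lean`: the coordinates `sunCoordι` and the surjection `kickCoeffMap`;
`SUNExpChartMinorisation.lean`: the chart of `SU(N)` dominates a multiple of Haar near `1`, so a
step law dominating Lebesgue-through-the-chart covers and the N-hit link Metropolis is uniformly
ergodic; `LinearSurjectionPushforward.lean`: box-uniform coefficients pushed by the surjection
dominate Lebesgue near `0` in the injective coordinates; `MetropolisSweepInstances.lean`: a covering
inversion-invariant step law gives a Wilson-ergodic sweep on any compact group).  The Wilson action
and measure are the Literature definitions (`wilsonAction`, `wilsonMeasure`), used by name; nothing
is cited as a fact.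

* §1 instances: Lebesgue measure on the coefficient space `ℝ^N × (ℝ^{pairs} × ℝ^{pairs})` is an
  additive Haar measure, regular, negation invariant.
* §2 `sunExp` (the exponential in the engine's coordinates), `sunKickCoeffLaw s` (uniform on the
  coefficient box `‖u‖_∞ < s`: probability, symmetric), `sunKickOfCoeffs u = exp(X(u))`,
  **`sunMetropolisKick N s`** — THE ENGINE'S `SU(N)` PROPOSAL LAW: a probability law, INVERSION
  INVARIANT (`exp(−X) = exp(X)⁻¹`, the box is symmetric, mean subtraction is linear).
* §3 **`exists_smul_chart_le_sunMetropolisKick`** — it dominates `c • (Haar_E|_W) ∘ sunExp⁻¹` for a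
  neighbourhood `W` of `0` in the coordinates and `c ≠ 0`.
* §4 **`exists_sunMetropolisKick_cover`** (some number of kicks dominates `δ ·` Haar from every
  start), **`sunMetropolisKick_uniformlyErgodic`** (+ `_of_continuous`): for every `N ≥ 1`, every
  kick size `s > 0` and every measurable weight pinched `0 < m ≤ p ≤ M` the `k`-hit link update
  `symMH (mulWalk (sunMetropolisKick N s)) p` converges to `Z⁻¹ p · Haar` geometrically in total
  variation from EVERY initial law, and `Z⁻¹ p · Haar` is its only invariant probability law under
  one hit; **`wilson_sunMetropolisSweep_uniformlyErgodic`** — THE ENGINE'S `SU(N)` METROPOLIS SWEEP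
  (any `nhit ≥ 1`, any scan through all edges of the torus, any `β`, continuous representation `ρ`)
  converges to the Literature `wilsonMeasure ρ β` from every start, which is its unique invariant
  probability law.  The `SU(3)` Metropolis row of the exactness table, typed.

NOT CLAIMED: any count of hits, any constant or rate (inverse function theorem + compactness:
astronomically small); floating point and the truncated Taylor exponential `expm_taylor`; HMC.
-/

noncomputable section

namespace Summit.Ventures.LatticeQCDFlow.Exactness

open MeasureTheory Measure ProbabilityTheory Set Filter Topology Metric Function NormedSpace
open Literature.MathematicalPhysics.QuantumFieldTheory
open scoped Matrix NNReal ENNReal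

variable (N : ℕ)

/-! ## §1 Lebesgue measure on the coefficient space -/

/-- Lebesgue measure on the off-diagonal coefficient space is an additive Haar measure. -/
instance isAddHaarMeasure_volume_upperPairs :
    IsAddHaarMeasure (volume : Measure ((UpperPair N → ℝ) × (UpperPair N → ℝ))) :=
  Measure.prod.instIsAddHaarMeasure _ _

/-- Lebesgue measure on the coefficient space is an additive Haar measure. -/
instance isAddHaarMeasure_volume_sunKickCoeffs : IsAddHaarMeasure (volume : Measure (SUNKickCoeffs N)) :=
  Measure.prod.instIsAddHaarMeasure _ _

/-- … regular. -/
instance regular_volume_sunKickCoeffs : (volume : Measure (SUNKickCoeffs N)).Regular :=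
  Regular.of_sigmaCompactSpace_of_isLocallyFiniteMeasure _

/-- … negation invariant. -/
instance isNegInvariant_volume_sunKickCoeffs : (volume : Measure (SUNKickCoeffs N)).IsNegInvariant :=
  IsAddHaarMeasure.isNegInvariant_of_regular _

/-- Negation on the coefficient space is measurable. -/
instance measurableNeg_sunKickCoeffs : MeasurableNeg (SUNKickCoeffs N) := ⟨continuous_neg.measurable⟩

/-! ## §2 The engine's kick law -/

/-- **The exponential in the engine's coordinates**: `sunExp c = exp (ι c) ∈ SU(N)`. -/
def sunExp : SUNCoords N → Matrix.specialUnitaryGroup (Fin N) ℂ := suExp (sunCoordι N) (sunCoordι_skew N)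

/-- `sunExp` is continuous. -/
theorem continuous_sunExp : Continuous (sunExp N) := continuous_suExp _ _

/-- `sunExp (−c) = (sunExp c)⁻¹`. -/
theorem sunExp_neg (c : SUNCoords N) : sunExp N (-c) = (sunExp N c)⁻¹ := suExp_neg _ _ c

/-- **The coefficient law**: uniform on the box `‖u‖_∞ < s` (every coordinate uniform on `(−s, s)`,
independently — the sup norm ball of the product space is the product of the coordinate intervals). -/
def sunKickCoeffLaw (s : ℝ) : Measure (SUNKickCoeffs N) :=
  (volume (ball (0 : SUNKickCoeffs N) s))⁻¹ • volume.restrict (ball (0 : SUNKickCoeffs N) s)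

/-- The coefficient law is a probability law for `s > 0`. -/
theorem isProbabilityMeasure_sunKickCoeffLaw {s : ℝ} (hs : 0 < s) : IsProbabilityMeasure (sunKickCoeffLaw N s) := by
  refine ⟨?_⟩
  rw [sunKickCoeffLaw, Measure.smul_apply, smul_eq_mul, Measure.restrict_apply MeasurableSet.univ, univ_inter,
    ENNReal.inv_mul_cancel (measure_ball_pos volume _ hs).ne' measure_ball_lt_top.ne]

/-- The coefficient law is `s`-finite. -/
instance sFinite_sunKickCoeffLaw (s : ℝ) : SFinite (sunKickCoeffLaw N s) := by
  unfold sunKickCoeffLaw; infer_instance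

/-- **The coefficient law is symmetric** (the box is symmetric, Lebesgue measure is negation invariant). -/
theorem map_neg_sunKickCoeffLaw (s : ℝ) : (sunKickCoeffLaw N s).map Neg.neg = sunKickCoeffLaw N s := by
  have hpre : (Neg.neg : SUNKickCoeffs N → SUNKickCoeffs N) ⁻¹' ball 0 s = ball 0 s := by ext u; simp
  rw [sunKickCoeffLaw, Measure.map_smul, ← hpre, ← Measure.restrict_map measurable_neg measurableSet_ball,
    Measure.map_neg_eq_self, hpre]

/-- **The proposal matrix of a coefficient vector**: `u ↦ exp (X(u)) ∈ SU(N)`. -/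
def sunKickOfCoeffs (u : SUNKickCoeffs N) : Matrix.specialUnitaryGroup (Fin N) ℂ := sunExp N (kickCoeffMap N u)

/-- `sunKickOfCoeffs = sunExp ∘ kickCoeffMap`. -/
theorem sunKickOfCoeffs_eq : sunKickOfCoeffs N = sunExp N ∘ kickCoeffMap N := rfl

/-- `sunKickOfCoeffs` is continuous. -/
theorem continuous_sunKickOfCoeffs : Continuous (sunKickOfCoeffs N) :=
  (continuous_sunExp N).comp (kickCoeffMap N).continuous_of_finiteDimensional

/-- `sunKickOfCoeffs` is measurable. -/
theorem measurable_sunKickOfCoeffs : Measurable (sunKickOfCoeffs N) := (continuous_sunKickOfCoeffs N).measurable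

/-- Negating the coefficients inverts the proposal: `exp(X(−u)) = exp(X(u))⁻¹`. -/
theorem sunKickOfCoeffs_neg (u : SUNKickCoeffs N) : sunKickOfCoeffs N (-u) = (sunKickOfCoeffs N u)⁻¹ := by
  rw [sunKickOfCoeffs, kickCoeffMap_neg, sunExp_neg]; rfl

variable (s : ℝ) [Fact (0 < s)]

/-- **`sunMetropolisKick N s`** — THE ENGINE'S `SU(N)` PROPOSAL LAW at kick size `s`: the image of the
uniform law on the coefficient box under `u ↦ exp (X(u))`. -/
def sunMetropolisKick : Measure (Matrix.specialUnitaryGroup (Fin N) ℂ) :=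
  (sunKickCoeffLaw N s).map (sunKickOfCoeffs N)

/-- The kick law is a probability law. -/
instance isProbabilityMeasure_sunMetropolisKick : IsProbabilityMeasure (sunMetropolisKick N s) := by
  haveI := isProbabilityMeasure_sunKickCoeffLaw N (Fact.out : 0 < s)
  exact isProbabilityMeasure_map (measurable_sunKickOfCoeffs N).aemeasurable

/-- **The kick law is inversion invariant** — the symmetry hypothesis of Metropolis exactness
(`mulWalkMH_invariant`). -/
instance isInvInvariant_sunMetropolisKick : (sunMetropolisKick N s).IsInvInvariant := by
  refine ⟨?_⟩
  have hcomp : (Inv.inv ∘ sunKickOfCoeffs N) = sunKickOfCoeffs N ∘ (Neg.neg : SUNKickCoeffs N → SUNKickCoeffs N) := by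
    funext u
    simp only [comp_apply, sunKickOfCoeffs_neg]
  rw [Measure.inv, sunMetropolisKick, Measure.map_map measurable_inv (measurable_sunKickOfCoeffs N), hcomp,
    ← Measure.map_map (measurable_sunKickOfCoeffs N) measurable_neg, map_neg_sunKickCoeffLaw]

/-! ## §3 The kick law dominates the chart measure -/

/-- **THE ENGINE'S KICK DOMINATES LEBESGUE-THROUGH-THE-CHART**: there are a neighbourhood `W` of `0`
in the coordinates of `𝔰𝔲(N)` and `c ≠ 0` with
`c • (Haar_E|_W) ∘ sunExp⁻¹ ≤ sunMetropolisKick N s` (`Haar_E` the additive Haar measure `addHaar`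
of the coordinate space). -/
theorem exists_smul_chart_le_sunMetropolisKick :
    ∃ W ∈ 𝓝 (0 : SUNCoords N), ∃ c : ℝ≥0∞, c ≠ 0 ∧
      c • ((Measure.addHaar : Measure (SUNCoords N)).restrict W).map (sunExp N) ≤ sunMetropolisKick N s := by
  have hs : 0 < s := Fact.out
  obtain ⟨W, hW, c₁, hc₁, hle⟩ := exists_smul_restrict_le_map_of_surjective (kickCoeffMap N)
    (kickCoeffMap_surjective N) volume (Measure.addHaar : Measure (SUNCoords N)) (ball_mem_nhds (0 : SUNKickCoeffs N) hs)
  have hvol0 : (volume (ball (0 : SUNKickCoeffs N) s))⁻¹ ≠ 0 := ENNReal.inv_ne_zero.2 measure_ball_lt_top.ne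
  have hmeasE : Measurable (sunExp N) := (continuous_sunExp N).measurable
  have hmeasT : Measurable (kickCoeffMap N) := (kickCoeffMap N).continuous_of_finiteDimensional.measurable
  refine ⟨W, hW, (volume (ball (0 : SUNKickCoeffs N) s))⁻¹ * c₁, mul_ne_zero hvol0 hc₁, ?_⟩
  rw [sunMetropolisKick, sunKickOfCoeffs_eq, ← Measure.map_map hmeasE hmeasT, sunKickCoeffLaw, Measure.map_smul,
    Measure.map_smul, mul_smul]
  refine Measure.le_iff'.2 fun A => ?_
  simp only [Measure.smul_apply, smul_eq_mul]
  refine mul_le_mul' le_rfl ?_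
  have h := Measure.map_mono hle hmeasE
  rw [Measure.map_smul] at h
  exact Measure.le_iff'.1 h A

/-! ## §4 Covering, the N-hit link update, and the sweep -/

variable [NeZero N]

/-- **THE ENGINE'S `SU(N)` KICKS COVER**: some number of kicks dominates `δ ·` Haar from every start. -/
theorem exists_sunMetropolisKick_cover :
    ∃ k : ℕ, ∃ δ : ℝ≥0∞, 0 < δ ∧ ∀ u : Matrix.specialUnitaryGroup (Fin N) ℂ,
      δ • haarProbability (Matrix.specialUnitaryGroup (Fin N) ℂ) ≤ nHit (mulWalk (sunMetropolisKick N s)) k u := by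
  obtain ⟨W, hW, c, hc, hle⟩ := exists_smul_chart_le_sunMetropolisKick N s
  exact sunKick_nHit_minorised (sunCoordι N) (sunCoordι_skew N) (sunCoordι_injective N) (sunCoordι_range N)
    Measure.addHaar hW hc hle

variable {p : Matrix.specialUnitaryGroup (Fin N) ℂ → ℝ} {m M : ℝ}

/-- **THE ENGINE'S N-HIT `SU(N)` LINK METROPOLIS IS UNIFORMLY ERGODIC.**  For every `N ≥ 1`, every
kick size `s > 0` and every measurable weight pinched `0 < m ≤ p ≤ M` (the other links frozen) there
are `k` and `ε ∈ (0, 1]` with `|μ₀(K^k)ᵗ(A) − (Z⁻¹p·Haar)(A)| ≤ (1 − ε)ᵗ` for every initial law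
`μ₀`, every `t`, every `A`, where `K = symMH (mulWalk (sunMetropolisKick N s)) p`; and `Z⁻¹ p · Haar`
is the ONLY probability law invariant under one hit. -/
theorem sunMetropolisKick_uniformlyErgodic (hp : Measurable p) (hm : 0 < m) (hpm : ∀ x, m ≤ p x)
    (hpM : ∀ x, p x ≤ M) :
    ∃ k : ℕ, ∃ ε : ℝ, 0 < ε ∧ ε ≤ 1 ∧
      (∀ (μ₀ : Measure (Matrix.specialUnitaryGroup (Fin N) ℂ)) [IsProbabilityMeasure μ₀] (t : ℕ)
          (A : Set (Matrix.specialUnitaryGroup (Fin N) ℂ)),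
        |((fun m' : Measure (Matrix.specialUnitaryGroup (Fin N) ℂ) =>
              m'.bind (nHit (symMH (mulWalk (sunMetropolisKick N s)) p) k))^[t] μ₀).real A
            - (gibbsProbability (haarProbability (Matrix.specialUnitaryGroup (Fin N) ℂ)) p).real A| ≤
          (1 - ε) ^ t) ∧
      ∀ (π' : Measure (Matrix.specialUnitaryGroup (Fin N) ℂ)) [IsProbabilityMeasure π'],
        Kernel.Invariant (symMH (mulWalk (sunMetropolisKick N s)) p) π' →
          π' = gibbsProbability (haarProbability (Matrix.specialUnitaryGroup (Fin N) ℂ)) p := by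
  obtain ⟨W, hW, c, hc, hle⟩ := exists_smul_chart_le_sunMetropolisKick N s
  exact sunLinkMetropolis_uniformlyErgodic (sunCoordι N) (sunCoordι_skew N) (sunCoordι_injective N)
    (sunCoordι_range N) Measure.addHaar hW hc hle hp hm hpm hpM

/-- **… in particular for every continuous positive weight** (pinched on the compact group): e.g. the
conditional Wilson weight `U ↦ exp(β/N · Re tr(U R†))` of a link given its staple sum `R`. -/
theorem sunMetropolisKick_uniformlyErgodic_of_continuous (hp : Continuous p) (hp0 : ∀ U, 0 < p U) :
    ∃ k : ℕ, ∃ ε : ℝ, 0 < ε ∧ ε ≤ 1 ∧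
      (∀ (μ₀ : Measure (Matrix.specialUnitaryGroup (Fin N) ℂ)) [IsProbabilityMeasure μ₀] (t : ℕ)
          (A : Set (Matrix.specialUnitaryGroup (Fin N) ℂ)),
        |((fun m' : Measure (Matrix.specialUnitaryGroup (Fin N) ℂ) =>
              m'.bind (nHit (symMH (mulWalk (sunMetropolisKick N s)) p) k))^[t] μ₀).real A
            - (gibbsProbability (haarProbability (Matrix.specialUnitaryGroup (Fin N) ℂ)) p).real A| ≤
          (1 - ε) ^ t) ∧
      ∀ (π' : Measure (Matrix.specialUnitaryGroup (Fin N) ℂ)) [IsProbabilityMeasure π'],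
        Kernel.Invariant (symMH (mulWalk (sunMetropolisKick N s)) p) π' →
          π' = gibbsProbability (haarProbability (Matrix.specialUnitaryGroup (Fin N) ℂ)) p := by
  obtain ⟨U₀, -, hU₀⟩ := isCompact_univ.exists_isMinOn (univ_nonempty (α := Matrix.specialUnitaryGroup (Fin N) ℂ))
    hp.continuousOn
  obtain ⟨U₁, -, hU₁⟩ := isCompact_univ.exists_isMaxOn (univ_nonempty (α := Matrix.specialUnitaryGroup (Fin N) ℂ))
    hp.continuousOn
  exact sunMetropolisKick_uniformlyErgodic N s hp.measurable (hp0 U₀)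
    (fun x => (isMinOn_iff.1 hU₀) x (mem_univ x)) (fun x => (isMaxOn_iff.1 hU₁) x (mem_univ x))

variable {d L M' : ℕ} (ρ : Matrix.specialUnitaryGroup (Fin N) ℂ →* Matrix (Fin M') (Fin M') ℂ)

/-- **THE ENGINE'S `SU(N)` METROPOLIS SWEEP CONVERGES TO THE `SU(N)` WILSON MEASURE** at every kick
size `s > 0` and every `nhit ≥ 1`: for continuous `ρ`, any `β`, any scan through all edges of the
torus there are `t` and `ε ∈ (0, 1]` with `|μ₀ (Sᵗ)^r(A) − wilsonMeasure(A)| ≤ (1 − ε)^r` for every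
initial law; and the Wilson measure is the ONLY probability law invariant under the sweep
`S = metropolisSweep (sunMetropolisKick N s) e^{−βS_W} n Ls`. -/
theorem wilson_sunMetropolisSweep_uniformlyErgodic [NeZero L] (hρ : Continuous ρ) (β : ℝ) {n : ℕ}
    (hn : 1 ≤ n) {Ls : List (Edge d L)} (hLs : ∀ e, e ∈ Ls) :
    ∃ t : ℕ, ∃ ε : ℝ, 0 < ε ∧ ε ≤ 1 ∧
      (∀ (μ₀ : Measure (GaugeConfig d L (Matrix.specialUnitaryGroup (Fin N) ℂ))) [IsProbabilityMeasure μ₀]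
          (r : ℕ) (A : Set (GaugeConfig d L (Matrix.specialUnitaryGroup (Fin N) ℂ))),
        |((fun m' : Measure (GaugeConfig d L (Matrix.specialUnitaryGroup (Fin N) ℂ)) =>
              m'.bind (nHit (metropolisSweep (sunMetropolisKick N s)
                (fun U : GaugeConfig d L (Matrix.specialUnitaryGroup (Fin N) ℂ) =>
                  Real.exp (-β * wilsonAction ρ U)) n Ls) t))^[r] μ₀).real A
            - (wilsonMeasure (d := d) (L := L) ρ β).real A| ≤ (1 - ε) ^ r) ∧
      ∀ (π' : Measure (GaugeConfig d L (Matrix.specialUnitaryGroup (Fin N) ℂ))) [IsProbabilityMeasure π'],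
        Kernel.Invariant (metropolisSweep (sunMetropolisKick N s)
          (fun U : GaugeConfig d L (Matrix.specialUnitaryGroup (Fin N) ℂ) => Real.exp (-β * wilsonAction ρ U))
          n Ls) π' → π' = wilsonMeasure (d := d) (L := L) ρ β := by
  obtain ⟨k, δ, hδ, hcov⟩ := exists_sunMetropolisKick_cover N s
  obtain ⟨ε, hε0, hε1, h⟩ := wilson_metropolisSweep_uniformlyErgodic (d := d) (L := L) ρ hρ β hcov hδ hn hLs
  exact ⟨k + 1, ε, hε0, hε1, h⟩

end Summit.Ventures.LatticeQCDFlow.Exactness
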